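/-
Copyright (c) 2026 the pub-hodgecm-mathlib formalisation cell (harness21).  Prover seat hodgecm-mathlib-B-p10 (g26) — ROAD W owner, 2026-09-01.
«R2-ram HOLDS»: the named ramified residue `RankOneEulerPoincareNonsplitRamified` of the rank-one Euler–Poincaré letter, discharged by the ★ fold.
-/
import Literature.NumberTheory.Rogawski1990.RankOneEulerPoincareNonsplitHolds      -- ★ (B-p10 g26) p843973: `rankOneEulerPoincareNonsplit_holds`
import Literature.NumberTheory.Rogawski1990.RankOneEulerPoincareNonsplitRamified   -- ★ (F0P2-p02) the NAMED residue `RankOneEulerPoincareNonsplitRamified` (stub `stub_N6nsR2ram`)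
import Literature.NumberTheory.Automorphic.UnitaryGroupNonsplitPlace               -- ★ `PlacesOver.subsingleton_of_smul_eq`
import HarnessLib

/-!
# The ramified residue of Rogawski's non-split Euler–Poincaré identity holds

Topic `NumberTheory/Rogawski1990`, namespace `Literature.NumberTheory.Rogawski1990`.  ONE THEOREM (a corollary): no definition, no named fact, no instance, no notation,
no `sorry`, no hypothesis; kernel lane.  Cell `pub/hodgecm-mathlib` (D-0151), crux H413 = `stmt-HodgeConjecture-24833`, line «N6nsGerm» (pen F0P2-p02), whose tree
skeleton ED. 1.10–1.11 carries the registered stub `stub_N6nsR2ram : RankOneEulerPoincareNonsplitRamified` (and closes `stub_N6nsR2EP` from it by ★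
`rankOneEulerPoincareNonsplit_of_ramified`).  HONEST LABEL: HC_CM is proved only modulo the cell's remaining named inputs (hLiu418, h413) until rung 0 closes; this
file is unconditional.

THE COROLLARY.  ★ `RankOneEulerPoincareNonsplitRamified` (F0P2-p02's NAMED residue) is, by its own docstring, the body of ★ `RankOneEulerPoincareNonsplit` at a place
`v` of `L⁺` carrying a `σ`-fixed place `w` of `L` and RAMIFIED in `L`; ★ `rankOneEulerPoincareNonsplit_holds` (p843973, the ROAD W fold) proves that body at EVERY
non-split `v` (`Subsingleton (PlacesOver L v)`), and a `σ`-fixed `w ∣ v` makes `v` non-split (★ `PlacesOver.subsingleton_of_smul_eq`).  Hence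
**`rankOneEulerPoincareNonsplitRamified_holds : RankOneEulerPoincareNonsplitRamified`** — the ramification hypothesis is not even used.  With it the pen closes
`stub_N6nsR2ram := rankOneEulerPoincareNonsplitRamified_holds` WITHOUT reshaping the registered stub list (alternatively `stub_N6nsR2EP :=
rankOneEulerPoincareNonsplit_holds` directly).

## References
* [Kottwitz1988] R. E. Kottwitz, *Tamagawa numbers*, Ann. of Math. 127 (1988), 629–646, §2 Theorem 2.
* [Rogawski1990] J. D. Rogawski, *Automorphic Representations of Unitary Groups in Three Variables* (1990), §12.6 p. 174.
* [CasselsFrohlichANT1967] J. W. S. Cassels, A. Fröhlich (eds.), *Algebraic Number Theory* (1967), Ch. VII Prop. 1.2 (ii).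
-/

set_option autoImplicit false

noncomputable section

namespace Literature.NumberTheory.Rogawski1990

open NumberField IsDedekindDomain
open Literature.NumberTheory.Automorphic Literature.NumberTheory.Automorphic.UnitaryGroup

/-- **THE RAMIFIED RESIDUE OF (R2) HOLDS**: `RankOneEulerPoincareNonsplitRamified` — at every place `v` of `L⁺` RAMIFIED in the CM field `L` (with its `σ`-fixed
`w ∣ v`), for every two-sided Haar measure and every canonical orbital-measure family on `U(Φ₂)(L⁺_v)`, there is a locally constant compactly supported `f` with
orbital integral `1` on the regular elliptic classes and `0` on the regular non-elliptic ones — read off ★ `rankOneEulerPoincareNonsplit_holds` (every non-split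
place) through ★ `PlacesOver.subsingleton_of_smul_eq`. [cite: Kottwitz1988, §2 Theorem 2] [cite: Rogawski1990, §12.6 p. 174] -/
theorem rankOneEulerPoincareNonsplitRamified_holds : RankOneEulerPoincareNonsplitRamified := by
  intro L _ _ _ v w hw _
  exact rankOneEulerPoincareNonsplit_holds L v
    (PlacesOver.subsingleton_of_smul_eq (IsCMField.complexConj L) (IsCMField.complexConj_ne_one L) w hw)

end Literature.NumberTheory.Rogawski1990

end
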